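import Summits.CriticalPhenomena.CardyFormulaZ2.Theorems.CardyComplexConeEdgePrecompactUFRSJunctionFunnelNumerics

/-!
# The junction funnel, part L (alternative build): frame, scales and gate from the physical junction
(line `qkz-strip-boundary-arm` of crux `CardyComplexCone.EdgePrecompact`, stmt-CriticalPhenomena-11387;
twelfth file of the registered sub-goal S2 = `ufrs_junctionFunnel`, lead c5, wave 4; registered
anchor `junction_mainAlt_JF`; continues `…UFRSJunctionFunnelNumerics.lean`. This is a re-landing of
`…UFRSJunctionFunnelMain.lean` (`junction_main_JF`, same content up to the order of `h ≤ N`, `N₀ ≤ N`)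
whose olean the build farm did not produce (a heartbeat-borderline final step, here made syntactic and
given head-room); `ufrs_junctionFunnel` imports this file.)

`junction_mainAlt_JF` — from the physical hypotheses of `ufrs_junctionFunnel` for ONE datum `G`
(carrying the junction edge `e₀`) and a small translation `u`: the lattice conversions, the frame
(`frame_choice_JF`, `exists_rot_JF`), the scales (`numerics_JF`), the second marked edge and its
distance (a near second edge would make every marked edge of `G` and of its translate near,
contradicting the hypothesis), the gate placed by `ψ` or by `ρ ∘ ψ` according to the chirality
and read by `gate_read_JF`, and `core_funnel_JF`. Conclusion: an orientation `φ`, a shape and gate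
parameters `N ≥ N₀`, `h ≤ N` such that on `ufrsJunctionGate φ corner N h` one physical corner is
visited by every orbit stretch of the completed configuration of `G` or of `shiftData G u`
through the respective inner faces that joins the `r`-ball about `m` to distance `≥ Kr`.

References: S. Smirnov, C. R. Acad. Sci. Paris 333 (2001), §2; H. Kesten, Comm. Math. Phys. 109
(1987), §2 (fences at a junction of boundary conditions).
-/

set_option linter.unusedVariables false

namespace Summit.CriticalPhenomena.CardyFormulaZ2.Cruxes.EdgePrecompact.QkzStripBoundaryArm

open MeasureTheory Filter Set Metric
open scoped Topology BigOperators Pointwise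
open Literature.Probability.LatticeModels Literature.Probability.Percolation
open Literature.Probability.RandomPlanarGeometry (DobrushinDomain)
open Summit.CriticalPhenomena.CardyFormulaZ2.Theses.CardyComplexCone

noncomputable section

/-! ## The main lemma: frame, scales and gate from the physical junction -/

set_option maxHeartbeats 400000 in
/-- **The funnel from the physical junction** (registered anchor `junction_mainAlt_JF` of
stmt-CriticalPhenomena-11387; `ufrs_junctionFunnel` is its unpacking against `ufrsStrands`). For
`ℤ²`-admissible rectangle data `G`, a small lattice translation `u` (`‖δu‖ < η`), a marked edge
`e₀` of `G` with midpoint `m`, scales `16 ≤ K`, `Kη ≤ r`, `64δ ≤ r`, `2N₀δ ≤ r`, `16Kr ≤` the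
sides, all marked edges of `G` and `shiftData G u` within `r/K` of `m` or beyond `Kr` (one of
them beyond), every corner of the rectangle within `r/K + η` or beyond `Kr - η`: there are an
orientation `φ`, a shape `corner` and gate parameters `N ≥ N₀`, `h ≤ N` such that on the gate
`ufrsJunctionGate φ corner N h` ONE physical corner is visited by every orbit stretch of the
completed configuration of `G` or of `shiftData G u`, through the respective inner faces, that
joins the `r`-ball about `m` to distance `≥ Kr` from `m`. Proof: lattice conversions
(`latticeSup_le_of_dist_le_HJ`, `far_lattice_JF`, `numerics_JF`), `frame_choice_JF`,
`exists_rot_JF`, the gate placed by `ψ` or `ρ ∘ ψ` and read by `gate_read_JF`, `core_funnel_JF`. -/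
theorem junction_mainAlt_JF : ∀ (N₀ : ℕ) (G : DiscreteDobrushin) (a₀ a₁ b₀ b₁ : ℝ), G.IsZdAdmissible → G.Ω = Set.Ioo a₀ a₁ ×ℂ Set.Ioo b₀ b₁ → ∀ (u : Site 2) (η : ℝ), ‖meshPoint G.δ u‖ < η → ∀ e₀ : Sym2 (Site 2), e₀ ∈ G.zdABEdges → ∀ (r K : ℝ), 16 ≤ K → K * η ≤ r → 64 * G.δ ≤ r → 2 * (N₀ : ℝ) * G.δ ≤ r → 16 * (K * r) ≤ min (a₁ - a₀) (b₁ - b₀) → (∀ e : Sym2 (Site 2), (e ∈ G.zdABEdges ∨ e ∈ (shiftData G u).zdABEdges) → dist (medialPoint G.δ e) (medialPoint G.δ e₀) ≤ r / K ∨ K * r ≤ dist (medialPoint G.δ e) (medialPoint G.δ e₀)) → (∃ e : Sym2 (Site 2), (e ∈ G.zdABEdges ∨ e ∈ (shiftData G u).zdABEdges) ∧ K * r ≤ dist (medialPoint G.δ e) (medialPoint G.δ e₀)) → (∀ q : ℂ, (q.re = a₀ ∨ q.re = a₁) → (q.im = b₀ ∨ q.im = b₁) → dist q (medialPoint G.δ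 e₀) ≤ r / K + η ∨ K * r - η ≤ dist q (medialPoint G.δ e₀)) → ∃ (φ : zdGraph 2 ≃g zdGraph 2) (corner : Bool) (N h : ℕ), h ≤ N ∧ N₀ ≤ N ∧ ∀ ω : BondConfig (Site 2), ω ∈ ufrsJunctionGate φ corner N h → ∃ c₀ : Site 2 × Fin 4, ∀ F : DiscreteDobrushin, (F = G ∨ F = shiftData G u) → ∀ (c : Site 2 × Fin 4) (i j' : ℕ), i ≤ j' → (∀ t, i ≤ t → t ≤ j' → F.IsInnerFace (cFace (cornerOrbit (F.bcBondConfig ω) c t))) → ((dist (meshPoint G.δ (cornerOrbit (F.bcBondConfig ω) c i).1) (medialPoint G.δ e₀) ≤ r ∧ K * r ≤ dist (meshPoint G.δ (cornerOrbit (F.bcBondConfig ω) c j').1) (medialPoint G.δ e₀)) ∨ (K * r ≤ dist (meshPoint G.δ (cornerOrbit (F.bcBondConfig ω) c i).1) (medialPoint G.δ e₀) ∧ dist (meshPoint G.δ (cornerOrbit (F.bcBondConfig ω) c j').1) (medialPoint G.δ e₀) ≤ r)) → ∃ s, i ≤ s ∧ s ≤ j' ∧ cornerOrbit (F.bcBondConfig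 ω) c s = c₀ := by
  intro N₀ G a₀ a₁ b₀ b₁ hG hGΩ u η hu e₀ he₀ r K hK hKη h64 hN₀ h16 hwin hfarE hcorn
  have hδ : 0 < G.δ := hG.delta_pos
  set δ := G.δ with hδdef
  have hη0 : 0 ≤ η := (norm_nonneg _).trans hu.le
  have hr0 : 0 < r := by nlinarith
  have hK0 : 0 < K := by linarith
  have hKr : 16 * r ≤ K * r := by nlinarith
  have hηr : 16 * η ≤ r := le_trans (by nlinarith) hKη
  have hrK : r / K ≤ r / 16 := div_le_div_of_nonneg_left hr0.le (by norm_num) hK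
  -- the junction edge
  obtain ⟨he₀E, ⟨nA, hnA, hA⟩, ⟨nB, hnB, hB⟩⟩ := (DiscreteDobrushin.mem_zdABEdges_iff G).1 he₀
  have hAB0 : nA ≠ nB := fun h => Set.disjoint_left.1 hG.disjoint hA (h ▸ hB)
  have he₀xy : e₀ = s(nA, nB) := (Sym2.mem_and_mem_iff hAB0).1 ⟨hnA, hnB⟩
  set m := medialPoint δ e₀ with hmdef
  have hadjG : (zdGraph 2).Adj nA nB ∧ nA ∈ meshVertices G.Ω δ ∧ nB ∈ meshVertices G.Ω δ := by
    rw [he₀xy] at he₀E; exact (dom_adj_iff_rect hG hGΩ).1 he₀E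
  -- the lattice box and the pivot `m̂ = (⌊m.re/δ⌋, ⌊m.im/δ⌋)`
  obtain ⟨hV, hBd⟩ := box_coords_HJ hGΩ hG
  have hdA : dist (meshPoint δ nA) m ≤ δ := by
    rw [hmdef, he₀xy]; exact dist_meshPoint_medialPoint_le_HJ hδ hadjG.1
  have hnA2 := latticeSup_le_of_dist_le_HJ hδ hdA
  rw [div_self hδ.ne', Int.floor_one] at hnA2
  -- the integer scales
  obtain ⟨g1, g2, g3, g4, g5, g6, g7, g8, g9, g10, g11, g12⟩ := numerics_JF δ r K η N₀ hδ hK hKη h64 hη0 hN₀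
  have hfl0 : 0 ≤ ⌊r / (2 * δ)⌋ := Int.floor_nonneg.2 (by positivity)
  set νc : ℤ := ⌊(r / K + η + 2 * δ) / δ⌋ + 1 with hνc
  set ν₀ : ℤ := ⌊(r / K + η + 2 * δ) / δ⌋ + 3 with hν₀
  set Lf : ℤ := ⌊(K * r - η) / (2 * δ)⌋ - 4 with hLf
  set hz : ℤ := ⌊η / δ⌋ + 2 with hhz
  set Nz : ℤ := ⌊r / (2 * δ)⌋ + (⌊(r / K + η + 2 * δ) / δ⌋ + 3) + 4 with hNz
  obtain ⟨N, hN⟩ : ∃ N : ℕ, (N : ℤ) = Nz := ⟨Nz.toNat, by omega⟩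
  obtain ⟨h, hh⟩ : ∃ h : ℕ, (h : ℤ) = hz := ⟨hz.toNat, by omega⟩
  -- the corners of the box: near or far
  have hcf : ∀ ic jc : ℤ, (ic = ⌊a₀ / δ⌋ + 1 ∨ ic = ⌈a₁ / δ⌉ - 1) → (jc = ⌊b₀ / δ⌋ + 1 ∨ jc = ⌈b₁ / δ⌉ - 1) →
      (|nA 0 - ic| ≤ ν₀ ∧ |nA 1 - jc| ≤ ν₀) ∨ (Lf ≤ |nA 0 - ic| ∨ Lf ≤ |nA 1 - jc|) := by
    intro ic jc hic hjc
    -- the corresponding corner of the rectangle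
    obtain ⟨qr, hqr, hqre⟩ : ∃ qr : ℝ, (qr = a₀ ∨ qr = a₁) ∧ |qr - δ * ic| ≤ δ := by
      rcases hic with rfl | rfl
      · have f1 := Int.lt_floor_add_one (a₀ / δ)
        have f1' : a₀ < δ * ((⌊a₀ / δ⌋ : ℝ) + 1) := by rw [← div_lt_iff₀' hδ]; exact f1
        have f2 := Int.floor_le (a₀ / δ)
        have f2' : δ * (⌊a₀ / δ⌋ : ℝ) ≤ a₀ := by rw [← le_div_iff₀' hδ]; exact f2
        refine ⟨a₀, Or.inl rfl, abs_le.2 ⟨?_, ?_⟩⟩ <;> push_cast <;> linarith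
      · have f1 := Int.le_ceil (a₁ / δ)
        have f1' : a₁ ≤ δ * (⌈a₁ / δ⌉ : ℝ) := by rw [← div_le_iff₀' hδ]; exact f1
        have f2 := Int.ceil_lt_add_one (a₁ / δ)
        have f2' : δ * ((⌈a₁ / δ⌉ : ℝ) - 1) < a₁ := by rw [← lt_div_iff₀' hδ]; linarith
        refine ⟨a₁, Or.inr rfl, abs_le.2 ⟨?_, ?_⟩⟩ <;> push_cast <;> linarith
    obtain ⟨qi, hqi, hqim⟩ : ∃ qi : ℝ, (qi = b₀ ∨ qi = b₁) ∧ |qi - δ * jc| ≤ δ := by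
      rcases hjc with rfl | rfl
      · have f1 := Int.lt_floor_add_one (b₀ / δ)
        have f1' : b₀ < δ * ((⌊b₀ / δ⌋ : ℝ) + 1) := by rw [← div_lt_iff₀' hδ]; exact f1
        have f2 := Int.floor_le (b₀ / δ)
        have f2' : δ * (⌊b₀ / δ⌋ : ℝ) ≤ b₀ := by rw [← le_div_iff₀' hδ]; exact f2
        refine ⟨b₀, Or.inl rfl, abs_le.2 ⟨?_, ?_⟩⟩ <;> push_cast <;> linarith
      · have f1 := Int.le_ceil (b₁ / δ)
        have f1' : b₁ ≤ δ * (⌈b₁ / δ⌉ : ℝ) := by rw [← div_le_iff₀' hδ]; exact f1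
        have f2 := Int.ceil_lt_add_one (b₁ / δ)
        have f2' : δ * ((⌈b₁ / δ⌉ : ℝ) - 1) < b₁ := by rw [← lt_div_iff₀' hδ]; linarith
        refine ⟨b₁, Or.inr rfl, abs_le.2 ⟨?_, ?_⟩⟩ <;> push_cast <;> linarith
    set q : ℂ := ⟨qr, qi⟩ with hq
    have hqc : dist q (meshPoint δ ![ic, jc]) ≤ 2 * δ :=
      dist_corner_le_JF hδ q ![ic, jc] (by simpa using hqre) (by simpa using hqim)
    rcases hcorn q hqr hqi with hnear | hfar
    · left
      have h1 : dist (meshPoint δ ![ic, jc]) m ≤ r / K + η + 2 * δ := by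
        have := dist_triangle (meshPoint δ ![ic, jc]) q m
        rw [dist_comm] at hqc; linarith
      have h2 := latticeSup_le_of_dist_le_HJ hδ h1
      simp only [Matrix.cons_val_zero, Matrix.cons_val_one] at h2
      rw [abs_le, abs_le]; omega
    · right
      have h1 : K * r - η - 2 * δ ≤ dist (meshPoint δ ![ic, jc]) m := by
        have := dist_triangle q (meshPoint δ ![ic, jc]) m
        linarith
      have h2 := far_lattice_JF hδ h1 (Lf + 1) (by push_cast; linarith)
      simp only [Matrix.cons_val_zero, Matrix.cons_val_one] at h2
      rw [le_abs, le_abs]; omega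
  -- the sides of the box
  have hsides : Lf ≤ (⌈a₁ / δ⌉ - 1) - (⌊a₀ / δ⌋ + 1) ∧ Lf ≤ (⌈b₁ / δ⌉ - 1) - (⌊b₀ / δ⌋ + 1) := by
    have s1 := Int.floor_le (a₀ / δ)
    have s2 := Int.le_ceil (a₁ / δ)
    have s3 := Int.floor_le (b₀ / δ)
    have s4 := Int.le_ceil (b₁ / δ)
    have s5 := Int.floor_le ((K * r - η) / (2 * δ))
    have hx := (min_le_left _ _).trans' h16
    have hy := (min_le_right _ _).trans' h16
    have e1 : a₁ / δ - a₀ / δ = (a₁ - a₀) / δ := by ring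
    have e2 : b₁ / δ - b₀ / δ = (b₁ - b₀) / δ := by ring
    have k1 : 16 * (K * r) / δ ≤ (a₁ - a₀) / δ := div_le_div_of_nonneg_right hx hδ.le
    have k2 : 16 * (K * r) / δ ≤ (b₁ - b₀) / δ := div_le_div_of_nonneg_right hy hδ.le
    have k3 : (K * r - η) / (2 * δ) ≤ 16 * (K * r) / δ - 8 := by
      rw [div_le_iff₀ (by positivity), sub_mul, div_mul_eq_mul_div, mul_div_assoc]
      rw [show 2 * δ / δ = 2 from by field_simp]
      nlinarith
    constructor
    · have : ((Lf : ℤ) : ℝ) ≤ ((⌈a₁ / δ⌉ - 1 - (⌊a₀ / δ⌋ + 1) : ℤ) : ℝ) := by rw [hLf]; push_cast; linarith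
      exact_mod_cast this
    · have : ((Lf : ℤ) : ℝ) ≤ ((⌈b₁ / δ⌉ - 1 - (⌊b₀ / δ⌋ + 1) : ℤ) : ℝ) := by rw [hLf]; push_cast; linarith
      exact_mod_cast this
  -- the frame
  have hnAbd := (hBd nA).1 (G.zdArcA_subset_zdBoundary hA)
  have hnBbd := (hBd nB).1 (G.zdArcB_subset_zdBoundary hB)
  obtain ⟨kμ, n, s, corner, onA, t₀, hs, hnn, hphys0, hflat0, hcor0⟩ :=
    frame_choice_JF _ _ _ _ ν₀ Lf nA nB (by omega) (by omega) hsides.1 hsides.2 hnAbd hnBbd hadjG.1 hcf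
  obtain ⟨π, ε, hrot⟩ := exists_rot_JF (1 - kμ)
  set Ψ : zdGraph 2 ≃g zdGraph 2 := (zdShiftIso (-n)).trans (zdSignedPermIso π ε) with hΨ
  obtain ⟨hk3, hk0⟩ := fin4_frame_index_JF kμ
  have hsymm : ∀ a b : ℤ, Ψ.symm ![a, b] 0 = n 0 + a * cornerUnit (kμ + 3) 0 + b * cornerUnit kμ 0 ∧
      Ψ.symm ![a, b] 1 = n 1 + a * cornerUnit (kμ + 3) 1 + b * cornerUnit kμ 1 := by
    intro a b
    have := frame_symm_coord_JF hrot n ![a, b]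
    rw [hk0, hk3] at this
    simp only [Matrix.cons_val_zero, Matrix.cons_val_one] at this
    exact this
  clear hk3 hk0
  have hsite : ∀ (a b : ℤ) (z : Site 2), z 0 = n 0 + a * cornerUnit (kμ + 3) 0 + b * cornerUnit kμ 0 →
      z 1 = n 1 + a * cornerUnit (kμ + 3) 1 + b * cornerUnit kμ 1 → z = Ψ.symm ![a, b] := by
    intro a b z h0 h1
    rw [Site.eq_iff_two, (hsymm a b).1, (hsymm a b).2]; exact ⟨h0, h1⟩
  -- the second marked edge, and its distance
  obtain ⟨eF, hAB, heF, heF0⟩ : ∃ eF, (∀ e ∈ G.zdABEdges, e = s(nA, nB) ∨ e = eF) ∧ eF ∈ G.zdABEdges ∧ eF ≠ e₀ := by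
    obtain ⟨p, p', hpp, hset⟩ := Set.ncard_eq_two.1 hG.ncard_zdABEdges_eq_two
    have he₀' := he₀; rw [hset] at he₀'
    rcases he₀' with rfl | rfl
    · refine ⟨p', fun e he => ?_, by rw [hset]; exact Or.inr rfl, hpp.symm⟩
      rw [hset] at he; rw [← he₀xy]; exact he
    · refine ⟨p, fun e he => ?_, by rw [hset]; exact Or.inl rfl, hpp⟩
      rw [hset] at he; rw [← he₀xy]; exact he.symm
  have heFfar : K * r ≤ dist (medialPoint δ eF) m := by
    rcases hwin eF (Or.inl heF) with hnear | hfar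
    · exfalso
      obtain ⟨e, he, hefar⟩ := hfarE
      have hsmall : ∀ e ∈ G.zdABEdges, dist (medialPoint δ e) m ≤ r / K := by
        intro e he
        rcases hAB e he with rfl | rfl
        · rw [← he₀xy, hmdef, dist_self]; positivity
        · exact hnear
      rcases he with he | he
      · have := hsmall e he; nlinarith
      · obtain ⟨e', rfl⟩ := (sym2Equiv (Site.shift u)).surjective e
        rw [shift_mem_zdABEdges_iff] at he
        have h1 := hsmall e' he
        have h2 : dist (medialPoint δ (sym2Equiv (Site.shift u) e')) m ≤ dist (medialPoint δ e') m + ‖meshPoint δ u‖ := by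
          rw [medialPoint_shift_JF, dist_eq_norm, dist_eq_norm, show medialPoint δ e' + meshPoint δ u - m =
            (medialPoint δ e' - m) + meshPoint δ u by ring]
          exact norm_add_le _ _
        rcases hwin _ (Or.inr ((shift_mem_zdABEdges_iff G u e').2 he)) with h3 | h3 <;> nlinarith
    · exact hfar
  have hfar : ∀ x ∈ eF, 4 * (N : ℤ) + 2 * h + 2 ≤ |Ψ x 0| ∨ 4 * (N : ℤ) + 2 * h + 2 ≤ |Ψ x 1| := by
    obtain ⟨heFE, -⟩ := (DiscreteDobrushin.mem_zdABEdges_iff G).1 heF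
    intro x hx
    induction eF using Sym2.ind with
    | h p p' =>
      have hpp' : (zdGraph 2).Adj p p' := ((dom_adj_iff_rect hG hGΩ).1 heFE).1
      have hxfar : K * r - δ ≤ dist (meshPoint δ x) m := by
        rcases Sym2.mem_iff.1 hx with hxp | hxp <;> rw [hxp]
        · have d1 := dist_meshPoint_medialPoint_le_HJ hδ hpp'
          rw [dist_comm] at d1
          have d2 := dist_triangle (medialPoint δ s(p, p')) (meshPoint δ p) m
          linarith
        · have d1 := dist_meshPoint_medialPoint_le_HJ hδ hpp'.symm
          rw [Sym2.eq_swap, dist_comm] at d1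
          have d2 := dist_triangle (medialPoint δ s(p, p')) (meshPoint δ p') m
          linarith
      have h2 := far_lattice_JF hδ hxfar (⌊(K * r - δ) / (2 * δ)⌋ - 2) g12
      rw [show Ψ x = Site.signedPerm π ε (x - n) from frame_apply_JF π ε n x]
      have hab := frame_abs_JF hrot (x - n)
      simp only [Pi.sub_apply] at hab
      rw [abs_le, abs_le] at hnn
      clear hphys0 hflat0 hcor0 hcf hsides hV hBd hwin hcorn hsymm hsite
      rcases hab with ⟨e0, e1⟩ | ⟨e0, e1⟩ <;> rw [e0, e1, le_abs, le_abs] <;> omega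
  -- the small translation
  have hu' : |Site.signedPerm π ε u 0| + 2 ≤ h ∧ |Site.signedPerm π ε u 1| + 2 ≤ h := by
    have hu0 : |δ * u 0| < η := lt_of_le_of_lt (by rw [← meshPoint_re]; exact Complex.abs_re_le_norm _) hu
    have hu1 : |δ * u 1| < η := lt_of_le_of_lt (by rw [← meshPoint_im]; exact Complex.abs_im_le_norm _) hu
    have k0 := abs_le_floor_JF hδ _ hu0
    have k1 := abs_le_floor_JF hδ _ hu1
    have hab := frame_abs_JF hrot u
    clear hphys0 hflat0 hcor0 hcf hsides hV hBd hwin hcorn hsymm hsite hfar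
    rcases hab with ⟨e0, e1⟩ | ⟨e0, e1⟩ <;> rw [e0, e1] <;> omega
  -- the physical geometry in the frame
  have hphys : ∀ a b : ℤ, -(Lf - ν₀ - 2) ≤ a → a ≤ Lf - ν₀ - 2 → -(Lf - ν₀ - 2) ≤ b → b ≤ Lf - ν₀ - 2 →
      (Ψ.symm ![a, b] ∈ meshVertices G.Ω G.δ ↔ (0 ≤ b ∧ (corner = true → 0 ≤ s * a))) := by
    intro a b h1 h2 h3 h4
    rw [hV, (hsymm a b).1, (hsymm a b).2]
    exact hphys0 a b h1 h2 h3 h4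
  have hflat : corner = false → nA = Ψ.symm ![0, 0] ∧ nB = Ψ.symm ![-s, 0] := by
    intro hc
    obtain ⟨h1, h2⟩ := hflat0 hc
    exact ⟨hsite 0 0 nA (by rw [h1.1]; ring) (by rw [h1.2]; ring), hsite (-s) 0 nB (by rw [h2.1]; ring) (by rw [h2.2]; ring)⟩
  have hcor : corner = true → 1 ≤ t₀ ∧ t₀ ≤ N ∧ (onA = true → nA = Ψ.symm ![0, t₀] ∧ nB = Ψ.symm ![0, t₀ - 1]) ∧
      (onA = false → nB = Ψ.symm ![s * t₀, 0] ∧ nA = Ψ.symm ![s * (t₀ - 1), 0]) := by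
    intro hc
    obtain ⟨h1, h2, h3, h4⟩ := hcor0 hc
    refine ⟨h1, by omega, fun ho => ?_, fun ho => ?_⟩
    · obtain ⟨⟨a1, a2⟩, ⟨b1, b2⟩⟩ := h3 ho
      exact ⟨hsite 0 t₀ nA (by rw [a1]; ring) (by rw [a2]; ring), hsite 0 (t₀ - 1) nB (by rw [b1]; ring) (by rw [b2]; ring)⟩
    · obtain ⟨⟨b1, b2⟩, ⟨a1, a2⟩⟩ := h4 ho
      exact ⟨hsite (s * t₀) 0 nB (by rw [b1]; ring) (by rw [b2]; ring),
        hsite (s * (t₀ - 1)) 0 nA (by rw [a1]; ring) (by rw [a2]; ring)⟩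
  -- the ends of a stretch, in lattice terms about `n`
  have inner : ∀ v : Site 2, dist (meshPoint δ v) m ≤ r →
      -(2 * (N : ℤ) - 1) ≤ (v - n) 0 ∧ (v - n) 0 ≤ 2 * N - 1 ∧ -(2 * (N : ℤ) - 1) ≤ (v - n) 1 ∧ (v - n) 1 ≤ 2 * N - 1 := by
    intro v hv
    have h3 := latticeSup_le_of_dist_le_HJ hδ hv
    simp only [Pi.sub_apply]
    rw [abs_le, abs_le] at hnn
    clear hphys0 hflat0 hcor0 hcf hsides hV hBd hwin hcorn hsymm hsite hfarE h16 hu hphys hflat hcor hu' hfar hAB hv hdA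
    omega
  have outer : ∀ v : Site 2, K * r ≤ dist (meshPoint δ v) m →
      4 * (N : ℤ) + h + 3 ≤ |(v - n) 0| ∨ 4 * (N : ℤ) + h + 3 ≤ |(v - n) 1| := by
    intro v hv
    have h3 := far_lattice_JF hδ hv (⌊K * r / (2 * δ)⌋ - 2) g11
    simp only [Pi.sub_apply]
    rw [abs_le, abs_le] at hnn
    clear hphys0 hflat0 hcor0 hcf hsides hV hBd hwin hcorn hsymm hsite hfarE h16 hu hphys hflat hcor hu' hfar hAB hv hdA
    rw [le_abs, le_abs]; omega
  -- the conclusion, given the arch of the gate in the frame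
  have key : ∀ ω : BondConfig (Site 2),
      (s = 1 → BondConfig.relabel (sym2Equiv Ψ.toEquiv) ω ∈ ufrsGateRef corner N h) →
      (s = -1 → BondConfig.relabel (sym2Equiv (reflectIso (0 : Fin 2)).toEquiv)
        (BondConfig.relabel (sym2Equiv Ψ.toEquiv) ω) ∈ ufrsGateRef corner N h) →
      ∃ c₀ : Site 2 × Fin 4, ∀ F : DiscreteDobrushin, (F = G ∨ F = shiftData G u) → ∀ (c : Site 2 × Fin 4) (i j' : ℕ), i ≤ j' →
        (∀ t, i ≤ t → t ≤ j' → F.IsInnerFace (cFace (cornerOrbit (F.bcBondConfig ω) c t))) →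
        ((dist (meshPoint δ (cornerOrbit (F.bcBondConfig ω) c i).1) m ≤ r ∧ K * r ≤ dist (meshPoint δ (cornerOrbit (F.bcBondConfig ω) c j').1) m) ∨
          (K * r ≤ dist (meshPoint δ (cornerOrbit (F.bcBondConfig ω) c i).1) m ∧ dist (meshPoint δ (cornerOrbit (F.bcBondConfig ω) c j').1) m ≤ r)) →
        ∃ s', i ≤ s' ∧ s' ≤ j' ∧ cornerOrbit (F.bcBondConfig ω) c s' = c₀ := by
    intro ω h1 h2
    obtain ⟨v₀, uf, g, k₀, P, Q, hPω, hQω, hPR, huF, hQR, hgF⟩ := gate_read_JF _ s corner N h hs h1 h2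
    refine ⟨(Ψ.symm v₀, k₀ - (1 - kμ)), fun F hF c i j' hij hin hends => ?_⟩
    refine core_funnel_JF G a₀ a₁ b₀ b₁ hG hGΩ π ε (1 - kμ) n hrot N h s corner onA t₀ (Lf - ν₀ - 2) nA nB u eF
      (by omega) (by omega) hs (by omega) hphys hA hB hAB hfar hflat hcor hu' ω v₀ uf g k₀ P Q hPω hQω hPR huF hQR hgF
      F hF c i j' hij hin ?_
    rcases hends with ⟨hi, hj⟩ | ⟨hi, hj⟩
    · exact Or.inl ⟨inner _ hi, outer _ hj⟩
    · exact Or.inr ⟨outer _ hi, inner _ hj⟩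
  -- the gate, in the orientation `ψ` or `ρ ∘ ψ` according to the chirality
  have hN₀N : N₀ ≤ N := by omega
  have hhN : h ≤ N := by omega
  rcases hs with rfl | rfl
  · refine ⟨Ψ, corner, N, h, hhN, hN₀N, fun ω hω => key ω (fun _ => (mem_ufrsJunctionGate_iff _ _ _ _ _).1 hω)
      (fun h' => absurd h' (by norm_num))⟩
  · refine ⟨Ψ.trans (reflectIso (0 : Fin 2)), corner, N, h, hhN, hN₀N, fun ω hω => key ω (fun h' => absurd h' (by norm_num))
      (fun _ => ?_)⟩
    rw [mem_ufrsJunctionGate_iff, relabel_trans_JF] at hω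
    exact hω

end

end Summit.CriticalPhenomena.CardyFormulaZ2.Cruxes.EdgePrecompact.QkzStripBoundaryArm
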